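import Summits.CriticalPhenomena.PercolationContinuityZ3.Theorems.Transplant.FKConnectivityAllQAntipodalTwoSpineDefs
import HarnessLib

/-!
# Two-spine word model of `U¹¹` — PEELING the outermost part of a spine (the mode transition table is exact)

Theorem file (`--supports stmt-CriticalPhenomena-4575`), FK sub-lane `prim-bschramm-fk-2` (gen 15); builds on p205010 (kernel
theorem, internal audit signed; external expert review pending).  No definitions of substance, no named facts, no sorries.

Appending the outermost letter `(k, b, b̄)` to the `A`-word `u` changes the two rows of `u` by at most one outermost object each, and
every moded row quantity of the longer rows is the corresponding quantity of the shorter rows in the PEELED modes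
`Mode.peel m k b` (memo g15 §6): `FK.TwoSpine.theta_append_A`, `FK.TwoSpine.theta_append_B`.  Consequently the diagram sum over the
words of the shape `oA ++ [k]` is the diagram sum of the PEELED DIAGRAM over the words of `oA` against the re-indexed family
(`FK.TwoSpine.dsum_peelA`), the re-indexed family is admissible for the peeled diagram — the new order constraints
`S_i(u·01, v) ≤ S_i(u·10, v)` being exactly flip-monotonicity (Theorem U for the peeled part) — and so the statement of the peeled
diagram for `(oA, oB)` implies the statement of the diagram for `(oA ++ [k], oB)` (`FK.TwoSpine.DStmt.of_peelA`, `…of_peelB`).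
[cite: Grimmett2006, §3.8 (pp. 61–62)]
-/

noncomputable section

namespace Summit.CriticalPhenomena.PercolationContinuityZ3.Theorems

namespace FK

namespace TwoSpine

open X2Word

/-! ### Rows of an appended word -/

/-- Rows distribute over concatenation (row `A`). [folklore] -/
theorem sRowA_append (u w : List SLetter) : sRowA (u ++ w) = sRowA u ++ sRowA w := by
  simp [sRowA, List.filter_append, List.map_append]

/-- Rows distribute over concatenation (row `B`). [folklore] -/
theorem sRowB_append (u w : List SLetter) : sRowB (u ++ w) = sRowB u ++ sRowB w := by
  simp [sRowB, List.filter_append, List.map_append]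

/-- Row `A` of a one-letter word. [folklore] -/
theorem sRowA_single (k : Kind) (b bb : Bool) : sRowA [(k, b, bb)] = if rowVis k b then [k] else [] := by
  rw [sRowA_cons]; simp

/-- Row `B` of a one-letter word. [folklore] -/
theorem sRowB_single (k : Kind) (b bb : Bool) : sRowB [(k, b, bb)] = if rowVis k bb then [k] else [] := by
  rw [sRowB_cons]; simp

/-- The visible object of a letter with bit `b` at a position of kind `k`, as a list: a particle for a connected parallel part,
a wall for a disconnected series part, nothing otherwise. [folklore] -/
def visObj (k : Kind) (b : Bool) : List Kind := if rowVis k b then [k] else []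

/-- `visObj` case table. [folklore] -/
@[simp] theorem visObj_P_true : visObj .P true = [.P] := rfl
/-- `visObj` case table. [folklore] -/
@[simp] theorem visObj_P_false : visObj .P false = [] := rfl
/-- `visObj` case table. [folklore] -/
@[simp] theorem visObj_W_true : visObj .W true = [] := rfl
/-- `visObj` case table. [folklore] -/
@[simp] theorem visObj_W_false : visObj .W false = [.W] := rfl

/-! ### Moded row quantities of an appended row = peeled-mode quantities of the inner row -/

/-- `rowC` after appending one visible object. [folklore] -/
theorem rowC_append_single (r : List Kind) (k : Kind) : rowC (r ++ [k]) = decide (k = .P) := by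
  simp [rowC, lastP]

/-- `rowCdot` after appending one visible object. [folklore] -/
theorem rowCdot_append_single (r : List Kind) (k : Kind) : rowCdot (r ++ [k]) = decide (k = .P) := by
  simp [rowCdot, lastP]

/-- `rowDel` after appending a particle: the wired `δ` of the inner row. [folklore] -/
theorem rowDel_append_P (r : List Kind) : rowDel (r ++ [.P]) = rowDelW r := by
  unfold rowDel rowDelW
  rw [headP_append]
  cases r <;> simp [headP, rowDel]

/-- `rowDel` after appending a wall: unchanged. [folklore] -/
theorem rowDel_append_W (r : List Kind) : rowDel (r ++ [.W]) = rowDel r := by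
  unfold rowDel
  rw [headP_append]
  cases r <;> simp [headP]

/-- `rowDelW` of a nonempty row is `rowDel`. [folklore] -/
theorem rowDelW_append_single (r : List Kind) (k : Kind) : rowDelW (r ++ [k]) = rowDel (r ++ [k]) := by
  simp [rowDelW]

/-- `rowCorr` after appending a particle: one more adjacent pair iff the inner row ends with a particle. [folklore] -/
theorem rowCorr_append_P (r : List Kind) : rowCorr (r ++ [.P]) = rowCorr r + (if rowC r then 1 else 0) := by
  have hP : ∀ b : Bool, adjP b [Kind.P] = if b then 1 else 0 := fun b => by cases b <;> rfl
  unfold rowCorr rowC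
  rw [adjP_append, hP]
  unfold lastFlag
  cases r with
  | nil => simp [lastP]
  | cons a l => simp

/-- `rowCorr` after appending a wall: unchanged. [folklore] -/
theorem rowCorr_append_W (r : List Kind) : rowCorr (r ++ [.W]) = rowCorr r := by
  have hW : ∀ b : Bool, adjP b [Kind.W] = 0 := fun b => by cases b <;> rfl
  unfold rowCorr
  rw [adjP_append, hW, Nat.add_zero]

/-- **The peeling table is exact, row by row**: for every mode `m`, kind `k` and bit `b`, the moded quantities of the row
`r ++ visObj k b` are those of `r` in the mode `(m.peel k b).1`, the cluster offset `rowCorr + shift` growing by `(m.peel k b).2`. [folklore] -/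
theorem peel_row (m : Mode) (k : Kind) (b : Bool) (r : List Kind) :
    m.conn (r ++ visObj k b) = (m.peel k b).1.conn r ∧
    m.connDot (r ++ visObj k b) = (m.peel k b).1.connDot r ∧
    m.del (r ++ visObj k b) = (m.peel k b).1.del r ∧
    rowCorr (r ++ visObj k b) + m.shift (r ++ visObj k b) = rowCorr r + (m.peel k b).1.shift r + (m.peel k b).2 := by
  cases m <;> cases k <;> cases b <;>
    simp [Mode.peel, Mode.conn, Mode.connDot, Mode.del, Mode.shift, visObj, rowVis,
      rowC_append_single, rowCdot_append_single, rowDel_append_P, rowDel_append_W, rowDelW_append_single,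
      rowCorr_append_P, rowCorr_append_W]

/-! ### The moded coefficient of an appended word pair -/

/-- Row `A` of a word with one more outermost letter. [folklore] -/
theorem sRowA_append_letter (u : List SLetter) (k : Kind) (b bb : Bool) :
    sRowA (u ++ [(k, b, bb)]) = sRowA u ++ visObj k b := by
  rw [sRowA_append, sRowA_single]; rfl

/-- Row `B` of a word with one more outermost letter. [folklore] -/
theorem sRowB_append_letter (u : List SLetter) (k : Kind) (b bb : Bool) :
    sRowB (u ++ [(k, b, bb)]) = sRowB u ++ visObj k bb := by
  rw [sRowB_append, sRowB_single]; rfl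

/-- The modes of a 4-tuple after peeling the outermost `A`-letter `(k, b, b̄)`, and the extra power of `q`. [folklore] -/
def peelA (m : Modes) (k : Kind) (b bb : Bool) : Modes × ℕ :=
  (((m.1.peel k b).1, (m.2.1.peel k bb).1, m.2.2), (m.1.peel k b).2 + (m.2.1.peel k bb).2)

/-- The modes of a 4-tuple after peeling the outermost `B`-letter `(k, b, b̄)`, and the extra power of `q`. [folklore] -/
def peelB (m : Modes) (k : Kind) (b bb : Bool) : Modes × ℕ :=
  ((m.1, m.2.1, (m.2.2.1.peel k b).1, (m.2.2.2.peel k bb).1), (m.2.2.1.peel k b).2 + (m.2.2.2.peel k bb).2)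

/-- **Peeling the outermost `A`-letter**: `Θ^m(u·ℓ, v) = q^{e(m,ℓ)} · Θ^{peelA m ℓ}(u, v)` (memo g15 §6). [folklore] -/
theorem theta_append_A (q : ℝ) (top : Top) (m : Modes) (u v : List SLetter) (k : Kind) (b bb : Bool) :
    theta q top m (u ++ [(k, b, bb)]) v = q ^ (peelA m k b bb).2 * theta q top (peelA m k b bb).1 u v := by
  obtain ⟨h1, h2, h3, h4⟩ := peel_row m.1 k b (sRowA u)
  obtain ⟨g1, g2, g3, g4⟩ := peel_row m.2.1 k bb (sRowB u)
  have hbase : baseExp m (u ++ [(k, b, bb)]) v = baseExp (peelA m k b bb).1 u v + (peelA m k b bb).2 := by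
    unfold baseExp peelA
    rw [sRowA_append_letter, sRowB_append_letter]
    simp only
    omega
  unfold theta
  simp only [sRowA_append_letter, sRowB_append_letter, h1, h2, h3, g1, g2, g3, hbase, pow_add]
  unfold peelA
  cases top <;> simp only <;> ring

/-- **Peeling the outermost `B`-letter**: `Θ^m(u, v·ℓ) = q^{e(m,ℓ)} · Θ^{peelB m ℓ}(u, v)`. [folklore] -/
theorem theta_append_B (q : ℝ) (top : Top) (m : Modes) (u v : List SLetter) (k : Kind) (b bb : Bool) :
    theta q top m u (v ++ [(k, b, bb)]) = q ^ (peelB m k b bb).2 * theta q top (peelB m k b bb).1 u v := by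
  obtain ⟨h1, h2, h3, h4⟩ := peel_row m.2.2.1 k b (sRowA v)
  obtain ⟨g1, g2, g3, g4⟩ := peel_row m.2.2.2 k bb (sRowB v)
  have hbase : baseExp m u (v ++ [(k, b, bb)]) = baseExp (peelB m k b bb).1 u v + (peelB m k b bb).2 := by
    unfold baseExp peelB
    rw [sRowA_append_letter, sRowB_append_letter]
    simp only
    omega
  unfold theta
  simp only [sRowA_append_letter, sRowB_append_letter, h1, h2, h3, g1, g2, g3, hbase, pow_add]
  unfold peelB
  cases top <;> simp only <;> ring

end TwoSpine

end FK

end Summit.CriticalPhenomena.PercolationContinuityZ3.Theorems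

end
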